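import Summits.CriticalPhenomena.Ising3DConformalLimit.Theorems.EnergyNotSigmaSquaredGapForcesFarMergingScreeningDefsAnnular
import Summits.CriticalPhenomena.Ising3DConformalLimit.Theorems.EnergyNotSigmaSquaredGapForcesFarMergingRootOpacity

/-! # One opaque step beyond every octave (stub `stub_opaqueStep`)
(line `screening-form-lemma-a1` of crux `GapForcesFarMerging`, item stmt-CriticalPhenomena-4468;
currencies `OnePinchScreeningDecayDyadic`, `OpaqueStepIO` of `Theorems/…ScreeningDefsAnnular.lean`)

`stub_opaqueStep : OnePinchScreeningDecayDyadic → OpaqueStepIO`. Write `A(r;M) = pinchScreen n r M`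
(box size `n` large) for the one-pinch screening ladder. Along a dyadic decay scale `M = 2^{K+3} = 2^i`
(`OnePinchScreeningDecayDyadic`: `A(n;M) ≤ C M^{-κ}` eventually in `n`, for infinitely many `i`) the ladder
starts at the ROOT FLOOR `A(2^{k₀};M) ≥ η(k₀) > 0` (`rootFloor`, landed, at EVERY root octave `k₀`, for
`M` and `n` large) and ends at `A(n;M) ≤ C M^{-κ} ≤ max(C,1)·λ^{2(K+3)}`, `λ = 2^{-κ/2}`. If no step of
`2^{k₀} → 2^{k₀+1} → ⋯ → 2^K → n` dropped by the factor `λ = 1 - c`, the ladder would grow at least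
geometrically, `A(n;M) > λ^{K-k₀+1} η`, whence `1 ≤ (max(C,1)/η)·λ^{K-k₀+1}`, impossible once `K - k₀ ≥ q`
(`(max(C,1)/η) λ^q < 1`; `q` depends on `k₀` through `η(k₀)` only, and the decay scale is chosen after `q`).
So for every large `n` the FIRST drop (`exists_drop_or_last`) is an octave step `k ∈ [k₀,K)` or the bulk
step `2^K → n`, from a positive value; either the bulk step drops for infinitely many `n`, or eventually an
octave step does and a pigeonhole over the finite range of `k` (`exists_frequently_of_eventually_exists`)
makes one `k` serve infinitely many `n`. No floors, no doubling windows, no positivity input beyond the root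
floor. References: Aizenman–Duminil-Copin 2021 (arXiv:1912.07973) §6.2 (the ladder); the counting is elementary. -/

noncomputable section

namespace Summit.CriticalPhenomena.Ising3DConformalLimit.EnergyNotSigmaSquaredGapForcesFarMerging

open scoped symmDiff ENNReal
open MeasureTheory Filter Finset
open Literature.Probability.LatticeModels Literature.Probability.Percolation
open Summit.CriticalPhenomena.Ising3DConformalLimit.Theorems.GapForcesFarMerging.Negative
  (e₁ e₂ cc2 xR up dn FarMergingShape SinglePinchLawShape)
open Summit.CriticalPhenomena.Ising3DConformalLimit.GapForcesFarMergingScreening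

/-! ### One-rate ladders with an appended last value: the first drop -/

-- adapted from `exists_drop_of_lt` (file `…RootOpacityDoubling.lean`), with the bulk value appended
/-- The first drop of a ladder `a(0), …, a(t), b` below a geometric rate: if `0 < λ`, `0 < a(0)` and the
last value satisfies `b < λ^{t+1} a(0)`, then either some octave step `i < t` drops, `a(i+1) ≤ λ a(i)`, from a
positive value `0 < a(i)`, or the last step drops, `b ≤ λ a(t)`, from `0 < a(t)` (before the first drop the
ladder grows at least geometrically, `a(i) ≥ λ^i a(0) > 0`). [folklore] -/
theorem exists_drop_or_last (a : ℕ → ℝ) (b : ℝ) {lam : ℝ} (hlam : 0 < lam) (h0 : 0 < a 0) (t : ℕ)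
    (h : b < lam ^ (t + 1) * a 0) :
    (∃ i < t, 0 < a i ∧ a (i + 1) ≤ lam * a i) ∨ (0 < a t ∧ b ≤ lam * a t) := by
  by_contra hne
  rw [not_or] at hne
  obtain ⟨hne1, hne2⟩ := hne
  push Not at hne1 hne2
  have key : ∀ i ≤ t, lam ^ i * a 0 ≤ a i := by
    intro i
    induction i with
    | zero => intro; simp
    | succ i ih =>
      intro hi
      have h1 := ih (Nat.le_of_succ_le hi)
      have h2 : 0 < a i := lt_of_lt_of_le (by positivity) h1
      calc lam ^ (i + 1) * a 0 = lam * (lam ^ i * a 0) := by ring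
        _ ≤ lam * a i := mul_le_mul_of_nonneg_left h1 hlam.le
        _ ≤ a (i + 1) := (hne1 i hi h2).le
  have ht : lam ^ t * a 0 ≤ a t := key t le_rfl
  have hpos : 0 < a t := lt_of_lt_of_le (by positivity) ht
  have h3 : lam ^ (t + 1) * a 0 ≤ lam * a t :=
    calc lam ^ (t + 1) * a 0 = lam * (lam ^ t * a 0) := by ring
      _ ≤ lam * a t := mul_le_mul_of_nonneg_left ht hlam.le
  have h4 := hne2 hpos
  linarith

/-! ### The stub -/

/-- **One opaque step beyond every octave (registered stub `stub_opaqueStep`).** One-pinch screening decay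
along powers of two forces `OpaqueStepIO` with `1 - c = 2^{-κ/2}`: for every root octave `k₀` some dyadic far
scale `M = 2^{K+3}`, `K ≥ k₀`, carries either an octave step `k ∈ [k₀, K)` with `0 < A(2^k;M)` and
`A(2^{k+1};M) ≤ (1-c) A(2^k;M)` for infinitely many box sizes `n`, or the bulk step `0 < A(2^K;M)`,
`A(n;M) ≤ (1-c) A(2^K;M)` for infinitely many `n` — the root floor `A(2^{k₀};M) ≥ η` (`rootFloor`), the decay
`A(n;M) ≤ C M^{-κ}` and `λ`-geometric growth without drops are incompatible once `K - k₀ ≥ q`,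
`(max(C,1)/η) λ^q < 1` (elementary counting over the landed `rootFloor`; the ladder is that of
Aizenman–Duminil-Copin 2021, §6.2). [folklore] -/
theorem stub_opaqueStep : OnePinchScreeningDecayDyadic → OpaqueStepIO := by
  intro hDecay
  classical
  obtain ⟨κ, C, hκ, hfreq⟩ := hDecay
  -- the drop rate `λ = 2^{-κ/2}` (`c = 1 - λ`)
  set lam : ℝ := (2 : ℝ) ^ (-(κ / 2)) with hlam
  have hlam0 : 0 < lam := Real.rpow_pos_of_pos two_pos _
  have hlam1 : lam < 1 := Real.rpow_lt_one_of_one_lt_of_neg one_lt_two (by linarith)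
  refine ⟨1 - lam, by linarith, fun k₀ => ?_⟩
  -- the root floor at the root octave `k₀`, for `m ≥ m₁`
  obtain ⟨η, hη, hroot⟩ := rootFloor k₀
  obtain ⟨m₁, hm₁⟩ := Filter.eventually_atTop.1 hroot
  -- `C₂ λ^q < 1`, `C₂ = max C 1 / η`
  set C₂ : ℝ := max C 1 / η with hC₂
  have hC₂pos : 0 < C₂ := by positivity
  obtain ⟨q, hq⟩ : ∃ q : ℕ, C₂ * lam ^ q < 1 := by
    obtain ⟨q, hq⟩ := exists_pow_lt_of_lt_one (inv_pos.2 hC₂pos) hlam1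
    exact ⟨q, (mul_lt_mul_of_pos_left hq hC₂pos).trans_eq (mul_inv_cancel₀ hC₂pos.ne')⟩
  -- a dyadic decay scale `2^i = 2^{K+3}` with `K ≥ k₀ + q` and `2^{K+3} ≥ m₁`
  obtain ⟨i, hige, hi⟩ := hfreq.forall_exists_of_atTop (max (k₀ + q + 3) m₁)
  obtain ⟨K, rfl⟩ : ∃ K : ℕ, i = K + 3 := ⟨i - 3, by have := le_of_max_le_left hige; omega⟩
  have hKk₀ : k₀ + q ≤ K := by have := le_of_max_le_left hige; omega
  have hMm₁ : m₁ ≤ 2 ^ (K + 3) := (le_of_max_le_right hige).trans Nat.lt_two_pow_self.le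
  refine ⟨K, by omega, ?_⟩
  -- the large box sizes: decay at `2^{K+3}` and the root floor at `(k₀, 2^{K+3})`
  have hE : ∀ᶠ n : ℕ in atTop,
      pinchScreen n n (2 ^ (K + 3)) ≤ C * ((2 ^ (K + 3) : ℕ) : ℝ) ^ (-κ) ∧
        η ≤ pinchScreen n (2 ^ k₀) (2 ^ (K + 3)) :=
    hi.and (hm₁ _ hMm₁)
  -- for each such `n`: an octave step in `[k₀, K)` or the bulk step drops, from a positive value
  have hstep : ∀ᶠ n : ℕ in atTop,
      (∃ j ∈ range (K - k₀), 0 < pinchScreen n (2 ^ (k₀ + j)) (2 ^ (K + 3)) ∧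
        pinchScreen n (2 ^ (k₀ + j + 1)) (2 ^ (K + 3)) ≤
          lam * pinchScreen n (2 ^ (k₀ + j)) (2 ^ (K + 3))) ∨
      (0 < pinchScreen n (2 ^ K) (2 ^ (K + 3)) ∧
        pinchScreen n n (2 ^ (K + 3)) ≤ lam * pinchScreen n (2 ^ K) (2 ^ (K + 3))) := by
    filter_upwards [hE] with n hn
    obtain ⟨hdec, hrt⟩ := hn
    -- the ladder `a j = A(2^{k₀+j}; 2^{K+3})`, `j ≤ t = K - k₀`; the last value is `A(n; 2^{K+3})`
    obtain ⟨a, ha⟩ : ∃ a : ℕ → ℝ, ∀ j, a j = pinchScreen n (2 ^ (k₀ + j)) (2 ^ (K + 3)) :=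
      ⟨_, fun _ => rfl⟩
    obtain ⟨t, ht⟩ : ∃ t : ℕ, t = K - k₀ := ⟨_, rfl⟩
    have ha0 : 0 < a 0 := by rw [ha]; exact lt_of_lt_of_le hη hrt
    have hat : a t = pinchScreen n (2 ^ K) (2 ^ (K + 3)) := by rw [ha, show k₀ + t = K by omega]
    -- the decay in powers of `λ`: `(2^{K+3})^{-κ} = λ^{2(K+3)} ≤ λ^{2(t+1)}`
    have hdecay' : pinchScreen n n (2 ^ (K + 3)) ≤ max C 1 * lam ^ (2 * (t + 1)) := by
      have h2 : ((2 ^ (K + 3) : ℕ) : ℝ) ^ (-κ) = lam ^ (2 * (K + 3)) := by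
        rw [Nat.cast_pow, Nat.cast_ofNat, hlam, ← Real.rpow_natCast (2 : ℝ) (K + 3),
          ← Real.rpow_mul (by norm_num : (0 : ℝ) ≤ 2),
          ← Real.rpow_natCast ((2 : ℝ) ^ (-(κ / 2))) (2 * (K + 3)),
          ← Real.rpow_mul (by norm_num : (0 : ℝ) ≤ 2)]
        congr 1; push_cast; ring
      calc pinchScreen n n (2 ^ (K + 3)) ≤ C * ((2 ^ (K + 3) : ℕ) : ℝ) ^ (-κ) := hdec
        _ ≤ max C 1 * ((2 ^ (K + 3) : ℕ) : ℝ) ^ (-κ) :=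
          mul_le_mul_of_nonneg_right (le_max_left _ _) (by positivity)
        _ = max C 1 * lam ^ (2 * (K + 3)) := by rw [h2]
        _ ≤ max C 1 * lam ^ (2 * (t + 1)) :=
          mul_le_mul_of_nonneg_left (pow_le_pow_of_le_one hlam0.le hlam1.le (by omega))
            (by positivity)
    -- the last value is below the geometric rate: else `1 ≤ C₂ λ^{t+1} ≤ C₂ λ^q < 1`
    have hlt : pinchScreen n n (2 ^ (K + 3)) < lam ^ (t + 1) * a 0 := by
      by_contra hge
      push Not at hge
      have h1 : lam ^ (t + 1) * η ≤ lam ^ (t + 1) * (max C 1 * lam ^ (t + 1)) :=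
        calc lam ^ (t + 1) * η ≤ lam ^ (t + 1) * a 0 :=
              mul_le_mul_of_nonneg_left (hrt.trans_eq (ha 0).symm) (by positivity)
          _ ≤ pinchScreen n n (2 ^ (K + 3)) := hge
          _ ≤ max C 1 * lam ^ (2 * (t + 1)) := hdecay'
          _ = lam ^ (t + 1) * (max C 1 * lam ^ (t + 1)) := by ring
      have h2 : η ≤ max C 1 * lam ^ (t + 1) := le_of_mul_le_mul_left h1 (by positivity)
      have h3 : 1 ≤ C₂ * lam ^ (t + 1) := by
        rw [hC₂, div_mul_eq_mul_div, le_div_iff₀ hη, one_mul]; exact h2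
      have h4 : C₂ * lam ^ (t + 1) ≤ C₂ * lam ^ q :=
        mul_le_mul_of_nonneg_left (pow_le_pow_of_le_one hlam0.le hlam1.le (by omega)) hC₂pos.le
      linarith
    rcases exists_drop_or_last a _ hlam0 ha0 t hlt with ⟨j, hjt, hpos, hdrop⟩ | ⟨hpos, hdrop⟩
    · refine Or.inl ⟨j, mem_range.2 (by omega), ?_, ?_⟩
      · rw [← ha]; exact hpos
      · rw [ha, ha] at hdrop; exact hdrop
    · refine Or.inr ⟨?_, ?_⟩
      · rw [← hat]; exact hpos
      · rw [hat] at hdrop; exact hdrop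
  -- either the bulk step drops for infinitely many `n`, or (pigeonhole over `[k₀, K)`) one octave step does
  rw [sub_sub_cancel]
  by_cases hb : ∃ᶠ n : ℕ in atTop, 0 < pinchScreen n (2 ^ K) (2 ^ (K + 3)) ∧
      pinchScreen n n (2 ^ (K + 3)) ≤ lam * pinchScreen n (2 ^ K) (2 ^ (K + 3))
  · exact Or.inr hb
  · rw [Filter.not_frequently] at hb
    have hoct : ∀ᶠ n : ℕ in atTop, ∃ j ∈ range (K - k₀),
        0 < pinchScreen n (2 ^ (k₀ + j)) (2 ^ (K + 3)) ∧
          pinchScreen n (2 ^ (k₀ + j + 1)) (2 ^ (K + 3)) ≤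
            lam * pinchScreen n (2 ^ (k₀ + j)) (2 ^ (K + 3)) := by
      filter_upwards [hstep, hb] with n hn hbn
      exact hn.resolve_right hbn
    obtain ⟨j, hj, hfr⟩ := exists_frequently_of_eventually_exists _ hoct
    rw [mem_range] at hj
    exact Or.inl ⟨k₀ + j, by omega, by omega, hfr⟩

end Summit.CriticalPhenomena.Ising3DConformalLimit.EnergyNotSigmaSquaredGapForcesFarMerging

end
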